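import Summits.CriticalPhenomena.PercolationContinuityZ3.Theorems.PercNearOneGluingNoHeavyConstsMDLXJointAvoidedMarker
import Summits.CriticalPhenomena.PercolationContinuityZ3.Theorems.PercNearOneGluingNoHeavyConstsMDLXJointMarkerLattice
import HarnessLib

/-!
# The DUAL observer inequality for the avoided cluster ("dual H-ν"): typed conjecture, its two marker corners, and the exact
# reduction `MDL(X)′(U) = H-ν(U) + (three-way link correction)`   (PAPER-2 track (ii); seat `prim-consts-2`, gen 14)

builds on p205010 (kernel theorem, internal audit signed; external expert review pending).  Support file (`--supports
stmt-CriticalPhenomena-4575`); memo `run/shared/lean/prim/consts/FROM-prim-consts-2-g14-DUAL-HNU.md` §1–§3.  One `Prop` definition (an OPEN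
conjecture, tagged `@[conjecture]`); theorems; no sorries; standard axioms.

Notation (as in `…ConstsMDLXJoint.lean`, `…ConstsMDLXJointAvoidedMarker.lean`): owner `s`, avoided set `X`, markers `y, z`;
`D = {s ↮ X}`, `𝒜 = {y ↮ {s}∪X}`, `T = 𝒜 ∩ D` (three-way separation), `W = {y ↔ z}`, `Y = {s ↔ y}`, `Z = {s ↔ z}`,
`G_y = {y ↔ X}` (the avoided cluster swallows `y`), `p' = μ(T∩W)/μ(T)`, `ν = μ(·|D)`, and the OBSERVER UNION
`B' = Z ∪ (W ∩ {y ↮ X})` (`= Z ⊔ (T∩W)` on `D`: "`z` is joined to `s`, or to a `y` that the avoided cluster has not swallowed").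

* `Consts.AvoidedClusterRepulsion` — **CONJECTURE (dual H-ν, gen 14).**  For every increasing event `E` of the avoided cluster
  `C_X = ⋃_{x∈X} C_x`:   `μ(T)·[μ(D)μ(D∩E∩B') − μ(D∩E)μ(D∩B')] + μ(T∩W)·[μ(D)μ(D∩E∩G_y) − μ(D∩E)μ(D∩G_y)] ≤ 0`,
  i.e. `Cov_ν(1_E, 1_{B'}) + p'·Cov_ν(1_E, 1_{G_y}) ≤ 0`: an increasing event of the avoided cluster lowers the observer union at least `p'`
  times as much as it raises the swallowing probability of the marker `y` (both covariances have a sign: `≤ 0` by van den Berg–Häggström–Kahn's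
  Thm 2.1 with the world decomposition along `C_X`, `≥ 0` by their Thm 1.3).  World form: with `π` the law of `K = C_X` under `ν` (positively
  associated, BHK Thm 1.3) the function `K ↦ P(B' | C_X = K) + p'·1{y ∈ V(K)}` is negatively correlated with every increasing function of `K`.
  WHY IT MATTERS (memo §2): by the law of total covariance along `σ(C_X)` and Harris' inequality inside each world, this conjecture implies the
  primal observer inequality H-ν of memo g13 §5 for EVERY monotone functional `F` of `C_s` — `Cov_ν(F, 1_{B'}) + p'·Cov_ν(F, 1_{G_y}) ≥ 0` —
  and H-ν(U) gives `Consts.MDLXJoint` at `U` whenever the up-event `U` does not raise the three-way link probability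
  (`Consts.mdlxJoint_indicator_of_hnu`, from the exact identity `Consts.mdlx_indicator_eq_hnu_add`, companion file).  The constant `p'` is SHARP
  (equality for `E = G_y` when `z` hangs off `y` only).
  EVIDENCE (exact rational recheck of every float candidate; max over ALL up-sets of the realised poset of `C_X` (vertex- and edge-level) by
  an exact min-cut closure; engines `prim-consts-2/g14/engines/dualhnu*.py`, kit bundle `prim-consts-2/g14/kit/split_bundle`): EXHAUSTIVE `|X| = 1`,
  n ≤ 6 — all 21 + 112 connected graphs, all ordered placements `(s,x,y,z)`, three weightings per graph from corner (`2^-k`, `1−2^-k`, k ≤ 10),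
  generic and dense palettes (kit j171224): **0 violations / 107 028**; n = 7: 0 / 650 random exact + 0 / 320 with edge-level up-sets (up to 407
  worlds) + 0 in 1 460 adversarial corner hill-climbs (half of them on the sharpness ratio, which they drive to exactly 1 and never below); `|X| = 2`
  directly: 0 / 300 (n = 6, 7); kit j172884 (random connected n = 7, 8, m ≤ 11, mixed palettes): 0 / 17 801; kit j172896 (EXHAUSTIVE n = 7: all 350
  connected graphs with m ≤ 10, all 840 placements, one weighting each): 0 / 234 756 — grand total 0 / 359 585 exact (graph, weighting, placement)
  instances, each a max over ALL up-sets (memo FROM-prim-consts-2-g14-DUAL-HNU.md §4); a second, independent engine (lead prim-nh-lead-4575 gen 108,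
  `lab-gen108/dualhnu/dualhnu_lead.py`: literal typed form incl. coincident placements and `|X| ≤ 2`, down-set min-cut) agrees: n ≤ 5 all graphs and n = 6,
  m ≤ 10, four palettes — 0 violations in 1 775 520 instances (272 320 non-trivial).  The sign
  statement "E does not raise the link probability given `T`" is FALSE in 3.9 % of the exhaustive instances, so dual H-ν neither contains nor is
  contained in J2 (`Consts.mdlxJoint_J2`'s conclusion): the two differ exactly by `μ(D)·ν(E∩T)·(P(W | E,T) − p')`.
* `Consts.avoidedClusterRepulsion_at_yReach` — **the corner `E = G_y` HOLDS** (event form): it is `Consts.mdlxJ2_at_yAvoid` (BHK Thms 1.3/1.4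
  with sets) after the bookkeeping `D ∩ G_y ∩ B' = D ∩ G_y ∩ Z`, `μ(D∩B') = μ(D∩Z) + μ(T∩W)`, `μ(D) = μ(D∩Y) + μ(D∩G_y) + μ(T)`.
* `Consts.avoidedClusterRepulsion_at_zReach` — **the corner `E = G_z = {z ↔ X}` HOLDS**: `D ∩ G_z ∩ B' = ∅`, and the rest is
  `Consts.mdlx_marker_reach_le` (`ν(s↔z) ≥ p'·ν(s↔y)`).
Companions: `…ConstsHnuMDLXIdentity.lean` (`Consts.mdlx_indicator_eq_hnu_add`: the EXACT identity `MDL(X)′(U) = H-ν(U) +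
μ(D)·[μ(T∩W)μ(U∩T) − μ(T)μ(U∩T∩W)]` for every event `U`; `Consts.hnu_ge_hnu_condS`: `Hν(F∘C_s) ≥ Hν(E[F|C_X]∘C_X)`), and
`…ConstsDualHnuConsequences.lean` (this conjecture ⟹ H-ν for every monotone `F` ⟹ `Consts.MDLXJoint` at every up-event that does not raise the
three-way link probability).
[cite: VandenbergHaggstromKahn2005, Thm. 1.3 (p. 6), Thm. 1.4 (p. 7) with Remark 1 after Thm. 1.2 (p. 5); Thm. 2.1 (p. 9), §2.1 pp. 10–13]
[status: open]
-/

noncomputable section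

namespace Summit.CriticalPhenomena.PercolationContinuityZ3.Theorems

open MeasureTheory Set Literature.Probability.LatticeModels Literature.Probability.Percolation
open scoped Classical

namespace Consts

variable {V : Type*} [Fintype V]

/-- **CONJECTURE (dual H-ν, gen 14) — a decreasing functional of the avoided cluster attracts the observer union at rate at least `p'`.**
For every finite weighted graph (`Fin n`, weights `w`, `μ = prodBernoulli w`), owner `s`, avoided set `X`, markers `y, z`, and every ANTITONE
functional `g` of the open edge cluster `C_X = ⋃_{x∈X} C_x` of the avoided set:
`0 ≤ μ(T)·[μ(D)∫_{D∩B'} g(C_X) − (∫_D g(C_X)) μ(D∩B')] + μ(T∩W)·[μ(D)∫_{D∩G_y} g(C_X) − (∫_D g(C_X)) μ(D∩G_y)]`, where `D = {s ↮ X}`,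
`T = {y ↮ {s}∪X} ∩ D`, `W = {y ↔ z}`, `B' = {s ↔ z} ∪ (W ∩ {y ↮ X})`, `G_y = {y ↔ X}` — i.e. `Cov_ν(g(C_X), 1_{B'}) + p'·Cov_ν(g(C_X), 1_{G_y}) ≥ 0`
(linear in `g`; at `g = 1 − 1_E`, `E` an increasing event of `C_X`, it is the event form `Cov_ν(1_E, 1_{B'}) + p'·Cov_ν(1_E, 1_{G_y}) ≤ 0`, and the
two forms are equivalent by the layer-cake decomposition of `g`).  OPEN (conjectured in this programme, PAPER-2 consts track, seat prim-consts-2,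
2026-08-22; exhaustive exact census `|X| = 1`, all up-sets of the realised cluster poset: n ≤ 6, 0 / 107 028; n = 7 with m ≤ 10, 0 / 234 756; random
n = 7, 8: 0 / 17 801; an independent second engine (lead gen 108, `|X| ≤ 2`, n = 6 m ≤ 10): 0 / 1 775 520; sharp at `E = G_y`).  The corners `E = G_y`,
`E = G_z` (event form) are `Consts.avoidedClusterRepulsion_at_yReach` / `_at_zReach`.  builds on p205010 (kernel theorem, internal audit signed; external
expert review pending). [cite: VandenbergHaggstromKahn2005, Thm. 1.3 (p. 6), Thm. 2.1 (p. 9), §2.1 pp. 10–13] [status: open] -/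
@[conjecture] def AvoidedClusterRepulsion : Prop :=
  ∀ (n : ℕ) (w : Sym2 (Fin n) → unitInterval) (s y z : Fin n) (X : Set (Fin n)) (g : Set (Sym2 (Fin n)) → ℝ), Antitone g →
    0 ≤ (prodBernoulli w).real ({ω : BondConfig (Fin n) | ∀ x ∈ insert s X, ¬ (openGraph ω).Reachable y x} ∩
          {ω | ∀ x ∈ X, ¬ (openGraph ω).Reachable s x}) *
        ((prodBernoulli w).real {ω : BondConfig (Fin n) | ∀ x ∈ X, ¬ (openGraph ω).Reachable s x} *
            (∫ ω in {ω : BondConfig (Fin n) | ∀ x ∈ X, ¬ (openGraph ω).Reachable s x} ∩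
                (openConn s z ∪ (openConn y z ∩ {ω | ∀ x ∈ X, ¬ (openGraph ω).Reachable y x})),
              g (⋃ x ∈ X, openEdgeCluster ω x) ∂(prodBernoulli w)) -
          (∫ ω in {ω : BondConfig (Fin n) | ∀ x ∈ X, ¬ (openGraph ω).Reachable s x},
              g (⋃ x ∈ X, openEdgeCluster ω x) ∂(prodBernoulli w)) *
            (prodBernoulli w).real ({ω : BondConfig (Fin n) | ∀ x ∈ X, ¬ (openGraph ω).Reachable s x} ∩
              (openConn s z ∪ (openConn y z ∩ {ω | ∀ x ∈ X, ¬ (openGraph ω).Reachable y x})))) +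
      (prodBernoulli w).real ({ω : BondConfig (Fin n) | ∀ x ∈ insert s X, ¬ (openGraph ω).Reachable y x} ∩
          {ω | ∀ x ∈ X, ¬ (openGraph ω).Reachable s x} ∩ openConn y z) *
        ((prodBernoulli w).real {ω : BondConfig (Fin n) | ∀ x ∈ X, ¬ (openGraph ω).Reachable s x} *
            (∫ ω in {ω : BondConfig (Fin n) | ∀ x ∈ X, ¬ (openGraph ω).Reachable s x} ∩
                {ω | ∃ x ∈ X, (openGraph ω).Reachable y x},
              g (⋃ x ∈ X, openEdgeCluster ω x) ∂(prodBernoulli w)) -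
          (∫ ω in {ω : BondConfig (Fin n) | ∀ x ∈ X, ¬ (openGraph ω).Reachable s x},
              g (⋃ x ∈ X, openEdgeCluster ω x) ∂(prodBernoulli w)) *
            (prodBernoulli w).real ({ω : BondConfig (Fin n) | ∀ x ∈ X, ¬ (openGraph ω).Reachable s x} ∩
              {ω | ∃ x ∈ X, (openGraph ω).Reachable y x}))

/-- **Dual H-ν at the corner `E = G_y = {y ↔ X}`** (event form; any finite vertex type):
`μ(T)·[μ(D)μ(D∩G_y∩B') − μ(D∩G_y)μ(D∩B')] + μ(T∩W)·[μ(D)μ(D∩G_y) − μ(D∩G_y)²] ≤ 0`.  After the bookkeeping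
`D∩G_y∩B' = D∩G_y∩Z`, `μ(D∩B') = μ(D∩Z) + μ(T∩W)`, `μ(D) = μ(D∩Y) + μ(D∩G_y) + μ(T)` this is literally `Consts.mdlxJ2_at_yAvoid`
(`μ(T∩W)μ(D∩G_y)μ(D∩Y) ≤ μ(T)[μ(D∩G_y)μ(D∩Z) − μ(D)μ(D∩G_y∩Z)]`).
[cite: VandenbergHaggstromKahn2005, Thm. 1.3 (p. 6), Thm. 1.4 (p. 7), Remark 1 (p. 5) — corollary, derived here] -/
theorem avoidedClusterRepulsion_at_yReach (w : Sym2 V → unitInterval) (s y z : V) (X : Set V) :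
    (prodBernoulli w).real ({ω : BondConfig V | ∀ x ∈ insert s X, ¬ (openGraph ω).Reachable y x} ∩
          {ω | ∀ x ∈ X, ¬ (openGraph ω).Reachable s x}) *
        ((prodBernoulli w).real {ω : BondConfig V | ∀ x ∈ X, ¬ (openGraph ω).Reachable s x} *
            (prodBernoulli w).real ({ω : BondConfig V | ∀ x ∈ X, ¬ (openGraph ω).Reachable s x} ∩
              {ω | ∃ x ∈ X, (openGraph ω).Reachable y x} ∩
              (openConn s z ∪ (openConn y z ∩ {ω | ∀ x ∈ X, ¬ (openGraph ω).Reachable y x}))) -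
          (prodBernoulli w).real ({ω : BondConfig V | ∀ x ∈ X, ¬ (openGraph ω).Reachable s x} ∩
              {ω | ∃ x ∈ X, (openGraph ω).Reachable y x}) *
            (prodBernoulli w).real ({ω : BondConfig V | ∀ x ∈ X, ¬ (openGraph ω).Reachable s x} ∩
              (openConn s z ∪ (openConn y z ∩ {ω | ∀ x ∈ X, ¬ (openGraph ω).Reachable y x})))) +
      (prodBernoulli w).real ({ω : BondConfig V | ∀ x ∈ insert s X, ¬ (openGraph ω).Reachable y x} ∩
          {ω | ∀ x ∈ X, ¬ (openGraph ω).Reachable s x} ∩ openConn y z) *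
        ((prodBernoulli w).real {ω : BondConfig V | ∀ x ∈ X, ¬ (openGraph ω).Reachable s x} *
            (prodBernoulli w).real ({ω : BondConfig V | ∀ x ∈ X, ¬ (openGraph ω).Reachable s x} ∩
              {ω | ∃ x ∈ X, (openGraph ω).Reachable y x} ∩ {ω | ∃ x ∈ X, (openGraph ω).Reachable y x}) -
          (prodBernoulli w).real ({ω : BondConfig V | ∀ x ∈ X, ¬ (openGraph ω).Reachable s x} ∩
              {ω | ∃ x ∈ X, (openGraph ω).Reachable y x}) *
            (prodBernoulli w).real ({ω : BondConfig V | ∀ x ∈ X, ¬ (openGraph ω).Reachable s x} ∩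
              {ω | ∃ x ∈ X, (openGraph ω).Reachable y x})) ≤ 0 := by
  classical
  set μ := prodBernoulli w with hμ
  have hmeas : ∀ S : Set (BondConfig V), MeasurableSet S := fun _ => MeasurableSet.of_discrete
  have h0 : ∀ S : Set (BondConfig V), 0 ≤ μ.real S := fun _ => measureReal_nonneg
  set D : Set (BondConfig V) := {ω | ∀ x ∈ X, ¬ (openGraph ω).Reachable s x} with hD
  set A : Set (BondConfig V) := {ω | ∀ x ∈ insert s X, ¬ (openGraph ω).Reachable y x} with hA
  set Ay : Set (BondConfig V) := {ω | ∀ x ∈ X, ¬ (openGraph ω).Reachable y x} with hAy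
  set Gy : Set (BondConfig V) := {ω | ∃ x ∈ X, (openGraph ω).Reachable y x} with hGy
  set Yv : Set (BondConfig V) := openConn s y with hYv
  set Zv : Set (BondConfig V) := openConn s z with hZv
  set Wv : Set (BondConfig V) := openConn y z with hWv
  set Bp : Set (BondConfig V) := Zv ∪ (Wv ∩ Ay) with hBp
  have mA : ∀ ω, ω ∈ A ↔ ¬ (openGraph ω).Reachable y s ∧ ∀ x ∈ X, ¬ (openGraph ω).Reachable y x := by
    intro ω; simp only [hA, mem_setOf_eq, mem_insert_iff, forall_eq_or_imp]
  have mD : ∀ ω, ω ∈ D ↔ ∀ x ∈ X, ¬ (openGraph ω).Reachable s x := fun ω => Iff.rfl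
  have mAy : ∀ ω, ω ∈ Ay ↔ ∀ x ∈ X, ¬ (openGraph ω).Reachable y x := fun ω => Iff.rfl
  have mGy : ∀ ω, ω ∈ Gy ↔ ∃ x ∈ X, (openGraph ω).Reachable y x := fun ω => Iff.rfl
  have mY : ∀ ω, ω ∈ Yv ↔ (openGraph ω).Reachable s y := fun ω => Iff.rfl
  have mZ : ∀ ω, ω ∈ Zv ↔ (openGraph ω).Reachable s z := fun ω => Iff.rfl
  have mW : ∀ ω, ω ∈ Wv ↔ (openGraph ω).Reachable y z := fun ω => Iff.rfl
  have mBp : ∀ ω, ω ∈ Bp ↔ ω ∈ Zv ∨ (ω ∈ Wv ∧ ω ∈ Ay) := fun ω => by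
    simp only [hBp, mem_union, mem_inter_iff]
  -- the kernel theorem of gen 12
  have key := mdlxJ2_at_yAvoid w s y z X
  change μ.real (A ∩ D ∩ Wv) * (μ.real D * μ.real (D ∩ Ay ∩ Yv) - μ.real (D ∩ Ay) * μ.real (D ∩ Yv)) ≤
    μ.real (A ∩ D) * (μ.real D * μ.real (D ∩ Ay ∩ Zv) - μ.real (D ∩ Ay) * μ.real (D ∩ Zv)) at key
  change μ.real (A ∩ D) * (μ.real D * μ.real (D ∩ Gy ∩ Bp) - μ.real (D ∩ Gy) * μ.real (D ∩ Bp)) +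
    μ.real (A ∩ D ∩ Wv) * (μ.real D * μ.real (D ∩ Gy ∩ Gy) - μ.real (D ∩ Gy) * μ.real (D ∩ Gy)) ≤ 0
  -- bookkeeping (1): `D ∩ G_y ∩ B' = D ∩ G_y ∩ Z`
  have e1 : D ∩ Gy ∩ Bp = D ∩ Gy ∩ Zv := by
    ext ω; simp only [mem_inter_iff, mBp, mGy, mAy]
    constructor
    · rintro ⟨⟨hd, hg⟩, hb⟩
      rcases hb with hz | ⟨-, hay⟩
      · exact ⟨⟨hd, hg⟩, hz⟩
      · obtain ⟨x, hx, hyx⟩ := hg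
        exact absurd hyx (hay x hx)
    · rintro ⟨⟨hd, hg⟩, hz⟩
      exact ⟨⟨hd, hg⟩, Or.inl hz⟩
  -- bookkeeping (2): `D ∩ B' = (D ∩ Z) ⊔ (T ∩ W)`
  have e2s : D ∩ Bp = D ∩ Zv ∪ A ∩ D ∩ Wv := by
    ext ω; simp only [mem_inter_iff, mem_union, mBp, mA, mD, mAy, mZ, mW]
    constructor
    · rintro ⟨hd, hz | ⟨hyz, hay⟩⟩
      · exact Or.inl ⟨hd, hz⟩
      · by_cases hsz : (openGraph ω).Reachable s z
        · exact Or.inl ⟨hd, hsz⟩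
        · refine Or.inr ⟨⟨⟨fun hys => hsz ?_, hay⟩, hd⟩, hyz⟩
          exact hys.symm.trans hyz
    · rintro (⟨hd, hz⟩ | ⟨⟨⟨hys, hay⟩, hd⟩, hyz⟩)
      · exact ⟨hd, Or.inl hz⟩
      · exact ⟨hd, Or.inr ⟨hyz, hay⟩⟩
  have d2 : Disjoint (D ∩ Zv) (A ∩ D ∩ Wv) := by
    rw [Set.disjoint_left]
    rintro ω ⟨-, hz⟩ ⟨⟨hAω, -⟩, hyz⟩
    rw [mA] at hAω
    exact hAω.1 ((show (openGraph ω).Reachable y z from hyz).trans (show (openGraph ω).Reachable s z from hz).symm)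
  have e2 : μ.real (D ∩ Bp) = μ.real (D ∩ Zv) + μ.real (A ∩ D ∩ Wv) := by
    rw [e2s, measureReal_union d2 (hmeas _)]
  -- bookkeeping (3): `D = (D ∩ Y) ⊔ (D ∩ G_y) ⊔ T`, via `D ∩ {y ↮ X} = T ⊔ (D ∩ Y)` and `D = (D ∩ Ay) ⊔ (D ∩ Gy)`
  have e3a : μ.real (D ∩ Ay) + μ.real (D ∩ Gy) = μ.real D := by
    have h := measureReal_inter_add_sdiff (μ := μ) (s := D) (hmeas Ay)
    have e : D \ Ay = D ∩ Gy := by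
      ext ω; simp only [mem_sdiff, mem_inter_iff, mAy, mGy, not_forall, not_not, exists_prop]
    rw [e] at h; exact h
  have e3b : μ.real (D ∩ Ay) = μ.real (A ∩ D) + μ.real (D ∩ Yv) := by
    have h := measureReal_inter_add_sdiff (μ := μ) (s := D ∩ Ay) (hmeas Yv)
    have eY : D ∩ Ay ∩ Yv = D ∩ Yv := by
      ext ω; simp only [mem_inter_iff, mD, mAy, mY]
      constructor
      · rintro ⟨⟨hd, -⟩, hy⟩; exact ⟨hd, hy⟩
      · rintro ⟨hd, hy⟩
        exact ⟨⟨hd, fun x hx hyx => hd x hx (hy.trans hyx)⟩, hy⟩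
    have eN : (D ∩ Ay) \ Yv = A ∩ D := by
      ext ω; simp only [mem_sdiff, mem_inter_iff, mD, mAy, mY, mA]
      constructor
      · rintro ⟨⟨hd, hay⟩, hny⟩
        exact ⟨⟨fun hys => hny hys.symm, hay⟩, hd⟩
      · rintro ⟨⟨hys, hay⟩, hd⟩
        exact ⟨⟨hd, hay⟩, fun hsy => hys hsy.symm⟩
    rw [eY, eN] at h; linarith
  -- the same identities restricted to `Yv` / `Zv` needed to rewrite `key`
  have e4 : D ∩ Ay ∩ Yv = D ∩ Yv := by
    ext ω; simp only [mem_inter_iff, mD, mAy, mY]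
    constructor
    · rintro ⟨⟨hd, -⟩, hy⟩; exact ⟨hd, hy⟩
    · rintro ⟨hd, hy⟩
      exact ⟨⟨hd, fun x hx hyx => hd x hx (hy.trans hyx)⟩, hy⟩
  have e5 : μ.real (D ∩ Ay ∩ Zv) + μ.real (D ∩ Gy ∩ Zv) = μ.real (D ∩ Zv) := by
    have h := measureReal_inter_add_sdiff (μ := μ) (s := D ∩ Zv) (hmeas Ay)
    have ea : D ∩ Zv ∩ Ay = D ∩ Ay ∩ Zv := by ext ω; simp only [mem_inter_iff]; tauto
    have eb : (D ∩ Zv) \ Ay = D ∩ Gy ∩ Zv := by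
      ext ω; simp only [mem_sdiff, mem_inter_iff, mAy, mGy, not_forall, not_not, exists_prop]; tauto
    rw [ea, eb] at h; exact h
  have e6 : D ∩ Gy ∩ Gy = D ∩ Gy := by rw [inter_assoc, inter_self]
  rw [e4] at key
  rw [e1, e2, e6]
  -- now everything is polynomial in the masses; substitute and close
  have eAy : μ.real (D ∩ Ay) = μ.real D - μ.real (D ∩ Gy) := by linarith [e3a]
  have eAyZ : μ.real (D ∩ Ay ∩ Zv) = μ.real (D ∩ Zv) - μ.real (D ∩ Gy ∩ Zv) := by linarith [e5]
  have eDsplit : μ.real D = μ.real (D ∩ Yv) + μ.real (D ∩ Gy) + μ.real (A ∩ D) := by linarith [e3a, e3b]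
  rw [eAy, eAyZ] at key
  linear_combination key + (μ.real (A ∩ D ∩ Wv) * μ.real (D ∩ Gy)) * eDsplit

/-- **Dual H-ν at the corner `E = G_z = {z ↔ X}`** (event form): `D ∩ G_z ∩ B' = ∅` (a swallowed `z` is joined neither to `s` nor to an
unswallowed `y`), so the inequality reads `μ(T∩W)·[μ(D)μ(D∩G_z∩G_y) − μ(D∩G_z)μ(D∩G_y)] ≤ μ(T)·μ(D∩G_z)·μ(D∩B')`, which follows from
`μ(D∩G_z∩G_y) ≤ μ(D∩G_z)`, `μ(D∩B') = μ(D∩Z) + μ(T∩W)`, `μ(D) − μ(D∩G_y) = μ(T) + μ(D∩Y)` and `Consts.mdlx_marker_reach_le`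
(`μ(T∩W)μ(D∩Y) ≤ μ(T)μ(D∩Z)`). [cite: VandenbergHaggstromKahn2005, Thm. 1.3 (p. 6), Thm. 1.4 (p. 7) — corollary, derived here] -/
theorem avoidedClusterRepulsion_at_zReach (w : Sym2 V → unitInterval) (s y z : V) (X : Set V) :
    (prodBernoulli w).real ({ω : BondConfig V | ∀ x ∈ insert s X, ¬ (openGraph ω).Reachable y x} ∩
          {ω | ∀ x ∈ X, ¬ (openGraph ω).Reachable s x}) *
        ((prodBernoulli w).real {ω : BondConfig V | ∀ x ∈ X, ¬ (openGraph ω).Reachable s x} *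
            (prodBernoulli w).real ({ω : BondConfig V | ∀ x ∈ X, ¬ (openGraph ω).Reachable s x} ∩
              {ω | ∃ x ∈ X, (openGraph ω).Reachable z x} ∩
              (openConn s z ∪ (openConn y z ∩ {ω | ∀ x ∈ X, ¬ (openGraph ω).Reachable y x}))) -
          (prodBernoulli w).real ({ω : BondConfig V | ∀ x ∈ X, ¬ (openGraph ω).Reachable s x} ∩
              {ω | ∃ x ∈ X, (openGraph ω).Reachable z x}) *
            (prodBernoulli w).real ({ω : BondConfig V | ∀ x ∈ X, ¬ (openGraph ω).Reachable s x} ∩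
              (openConn s z ∪ (openConn y z ∩ {ω | ∀ x ∈ X, ¬ (openGraph ω).Reachable y x})))) +
      (prodBernoulli w).real ({ω : BondConfig V | ∀ x ∈ insert s X, ¬ (openGraph ω).Reachable y x} ∩
          {ω | ∀ x ∈ X, ¬ (openGraph ω).Reachable s x} ∩ openConn y z) *
        ((prodBernoulli w).real {ω : BondConfig V | ∀ x ∈ X, ¬ (openGraph ω).Reachable s x} *
            (prodBernoulli w).real ({ω : BondConfig V | ∀ x ∈ X, ¬ (openGraph ω).Reachable s x} ∩
              {ω | ∃ x ∈ X, (openGraph ω).Reachable z x} ∩ {ω | ∃ x ∈ X, (openGraph ω).Reachable y x}) -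
          (prodBernoulli w).real ({ω : BondConfig V | ∀ x ∈ X, ¬ (openGraph ω).Reachable s x} ∩
              {ω | ∃ x ∈ X, (openGraph ω).Reachable z x}) *
            (prodBernoulli w).real ({ω : BondConfig V | ∀ x ∈ X, ¬ (openGraph ω).Reachable s x} ∩
              {ω | ∃ x ∈ X, (openGraph ω).Reachable y x})) ≤ 0 := by
  classical
  set μ := prodBernoulli w with hμ
  have hmeas : ∀ S : Set (BondConfig V), MeasurableSet S := fun _ => MeasurableSet.of_discrete
  have h0 : ∀ S : Set (BondConfig V), 0 ≤ μ.real S := fun _ => measureReal_nonneg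
  set D : Set (BondConfig V) := {ω | ∀ x ∈ X, ¬ (openGraph ω).Reachable s x} with hD
  set A : Set (BondConfig V) := {ω | ∀ x ∈ insert s X, ¬ (openGraph ω).Reachable y x} with hA
  set Ay : Set (BondConfig V) := {ω | ∀ x ∈ X, ¬ (openGraph ω).Reachable y x} with hAy
  set Gy : Set (BondConfig V) := {ω | ∃ x ∈ X, (openGraph ω).Reachable y x} with hGy
  set Gz : Set (BondConfig V) := {ω | ∃ x ∈ X, (openGraph ω).Reachable z x} with hGz
  set Yv : Set (BondConfig V) := openConn s y with hYv
  set Zv : Set (BondConfig V) := openConn s z with hZv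
  set Wv : Set (BondConfig V) := openConn y z with hWv
  set Bp : Set (BondConfig V) := Zv ∪ (Wv ∩ Ay) with hBp
  have mA : ∀ ω, ω ∈ A ↔ ¬ (openGraph ω).Reachable y s ∧ ∀ x ∈ X, ¬ (openGraph ω).Reachable y x := by
    intro ω; simp only [hA, mem_setOf_eq, mem_insert_iff, forall_eq_or_imp]
  have mD : ∀ ω, ω ∈ D ↔ ∀ x ∈ X, ¬ (openGraph ω).Reachable s x := fun ω => Iff.rfl
  have mAy : ∀ ω, ω ∈ Ay ↔ ∀ x ∈ X, ¬ (openGraph ω).Reachable y x := fun ω => Iff.rfl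
  have mGy : ∀ ω, ω ∈ Gy ↔ ∃ x ∈ X, (openGraph ω).Reachable y x := fun ω => Iff.rfl
  have mGz : ∀ ω, ω ∈ Gz ↔ ∃ x ∈ X, (openGraph ω).Reachable z x := fun ω => Iff.rfl
  have mY : ∀ ω, ω ∈ Yv ↔ (openGraph ω).Reachable s y := fun ω => Iff.rfl
  have mZ : ∀ ω, ω ∈ Zv ↔ (openGraph ω).Reachable s z := fun ω => Iff.rfl
  have mW : ∀ ω, ω ∈ Wv ↔ (openGraph ω).Reachable y z := fun ω => Iff.rfl
  have mBp : ∀ ω, ω ∈ Bp ↔ ω ∈ Zv ∨ (ω ∈ Wv ∧ ω ∈ Ay) := fun ω => by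
    simp only [hBp, mem_union, mem_inter_iff]
  have key := mdlx_marker_reach_le w s y z X
  change μ.real (A ∩ D ∩ Wv) * μ.real (D ∩ Yv) ≤ μ.real (A ∩ D) * μ.real (D ∩ Zv) at key
  change μ.real (A ∩ D) * (μ.real D * μ.real (D ∩ Gz ∩ Bp) - μ.real (D ∩ Gz) * μ.real (D ∩ Bp)) +
    μ.real (A ∩ D ∩ Wv) * (μ.real D * μ.real (D ∩ Gz ∩ Gy) - μ.real (D ∩ Gz) * μ.real (D ∩ Gy)) ≤ 0
  -- (1) `D ∩ G_z ∩ B' = ∅`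
  have e1 : D ∩ Gz ∩ Bp = ∅ := by
    ext ω; simp only [mem_inter_iff, mBp, mGz, mAy, mD, mZ, mW, mem_empty_iff_false, iff_false]
    rintro ⟨⟨hd, ⟨x, hx, hzx⟩⟩, hz | ⟨hyz, hay⟩⟩
    · exact hd x hx ((show (openGraph ω).Reachable s z from hz).trans hzx)
    · exact hay x hx ((show (openGraph ω).Reachable y z from hyz).trans hzx)
  -- (2) `μ(D ∩ B') = μ(D ∩ Z) + μ(T ∩ W)`
  have e2s : D ∩ Bp = D ∩ Zv ∪ A ∩ D ∩ Wv := by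
    ext ω; simp only [mem_inter_iff, mem_union, mBp, mA, mD, mAy, mZ, mW]
    constructor
    · rintro ⟨hd, hz | ⟨hyz, hay⟩⟩
      · exact Or.inl ⟨hd, hz⟩
      · by_cases hsz : (openGraph ω).Reachable s z
        · exact Or.inl ⟨hd, hsz⟩
        · refine Or.inr ⟨⟨⟨fun hys => hsz ?_, hay⟩, hd⟩, hyz⟩
          exact hys.symm.trans hyz
    · rintro (⟨hd, hz⟩ | ⟨⟨⟨hys, hay⟩, hd⟩, hyz⟩)
      · exact ⟨hd, Or.inl hz⟩
      · exact ⟨hd, Or.inr ⟨hyz, hay⟩⟩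
  have d2 : Disjoint (D ∩ Zv) (A ∩ D ∩ Wv) := by
    rw [Set.disjoint_left]
    rintro ω ⟨-, hz⟩ ⟨⟨hAω, -⟩, hyz⟩
    rw [mA] at hAω
    exact hAω.1 ((show (openGraph ω).Reachable y z from hyz).trans (show (openGraph ω).Reachable s z from hz).symm)
  have e2 : μ.real (D ∩ Bp) = μ.real (D ∩ Zv) + μ.real (A ∩ D ∩ Wv) := by
    rw [e2s, measureReal_union d2 (hmeas _)]
  -- (3) `μ(D) = μ(D ∩ Y) + μ(D ∩ G_y) + μ(T)`
  have e3a : μ.real (D ∩ Ay) + μ.real (D ∩ Gy) = μ.real D := by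
    have h := measureReal_inter_add_sdiff (μ := μ) (s := D) (hmeas Ay)
    have e : D \ Ay = D ∩ Gy := by
      ext ω; simp only [mem_sdiff, mem_inter_iff, mAy, mGy, not_forall, not_not, exists_prop]
    rw [e] at h; exact h
  have e3b : μ.real (D ∩ Ay) = μ.real (A ∩ D) + μ.real (D ∩ Yv) := by
    have h := measureReal_inter_add_sdiff (μ := μ) (s := D ∩ Ay) (hmeas Yv)
    have eY : D ∩ Ay ∩ Yv = D ∩ Yv := by
      ext ω; simp only [mem_inter_iff, mD, mAy, mY]
      constructor
      · rintro ⟨⟨hd, -⟩, hy⟩; exact ⟨hd, hy⟩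
      · rintro ⟨hd, hy⟩
        exact ⟨⟨hd, fun x hx hyx => hd x hx (hy.trans hyx)⟩, hy⟩
    have eN : (D ∩ Ay) \ Yv = A ∩ D := by
      ext ω; simp only [mem_sdiff, mem_inter_iff, mD, mAy, mY, mA]
      constructor
      · rintro ⟨⟨hd, hay⟩, hny⟩
        exact ⟨⟨fun hys => hny hys.symm, hay⟩, hd⟩
      · rintro ⟨⟨hys, hay⟩, hd⟩
        exact ⟨⟨hd, hay⟩, fun hsy => hys hsy.symm⟩
    rw [eY, eN] at h; linarith
  have eDsplit : μ.real D = μ.real (D ∩ Yv) + μ.real (D ∩ Gy) + μ.real (A ∩ D) := by linarith [e3a, e3b]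
  -- (4) `μ(D ∩ G_z ∩ G_y) ≤ μ(D ∩ G_z)`
  have e4 : μ.real (D ∩ Gz ∩ Gy) ≤ μ.real (D ∩ Gz) := measureReal_mono inter_subset_left
  rw [e1, measureReal_empty, e2]
  have h1 := mul_le_mul_of_nonneg_left e4 (mul_nonneg (h0 (A ∩ D ∩ Wv)) (h0 D))
  have h2 := mul_le_mul_of_nonneg_left key (h0 (D ∩ Gz))
  linear_combination h1 + h2 + (μ.real (A ∩ D ∩ Wv) * μ.real (D ∩ Gz)) * eDsplit

end Consts

end Summit.CriticalPhenomena.PercolationContinuityZ3.Theorems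

end
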